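import Summits.AtomisticToContinuum.HydrodynamicLimit.Theorems.RelayRaceLocalityNearConstantShortTimeHLBallGaussianEstimateA
import HarnessLib

/-!
# Crux `NearConstantShortTimeHL` (stmt-AtomisticToContinuum-12502), line `small-tilt-domination` —
# stub `ball_gaussian_estimate` (the unfolded `stub_ballGaussianEstimate : BallGaussianEstimate`)

Support file (`--supports stmt-AtomisticToContinuum-12502`) proving the registered stub
`ball_gaussian_estimate`: the per-ball probabilistic input of the conditional-Gaussian chessboard
estimate `stub_velocityLD`. On ONE mesoscopic ball holding `k ≤ Rν` particles with independent
velocities `vᵢ ∼ N(uᵢ, θᵢ I₃)` in the box `M⁻¹ ≤ θᵢ ≤ M`, `‖uᵢ‖ ≤ M`, the CAPPED quadratic forms of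
the centred sums `S = Σᵢ (vᵢ − uᵢ)` and `T = Σᵢ Yᵢ`, `Yᵢ = ‖vᵢ‖²/2 − ‖uᵢ‖²/2 − 3θᵢ/2`, together with
the linear tail `T 𝟙{T > ν}`, have an exponential moment bounded UNIFORMLY in `ν ≥ 1`; and the
one-particle linear bound `E exp(s Y₊) ≤ exp(B s)` holds for `0 ≤ s ≤ γ₀`.

PROOF. (i) `∫ e^{γ₀(A + T₁ + T₂)} ≤ ∫ e^{3γ₀A} + ∫ e^{3γ₀T₁} + ∫ e^{3γ₀T₂}`; each of the three
nonnegative capped variables has a geometric tail `P(j ≤ X) ≤ D e^{−cj}` with `c, D` depending on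
`M, R` only (§1, from the Chernoff bounds of part A: the thresholds `√(jν)` of the capped quadratic
forms are matched by the Chernoff parameter `t ∝ √(j/ν)`, admissible because the cap forces
`j ≤ ν`; the linear tail uses `t = a` at the threshold `max(j, ν)`), and a geometric tail gives an
exponential moment for `γ ≤ c/2` (part A). (ii) Convexity of `exp` in the exponent:
`e^{sY₊} ≤ (1 − s/γ₀) + (s/γ₀) e^{γ₀Y₊}`, `e^{γ₀Y₊} ≤ 1 + e^{γ₀Y}`, the sub-Gaussian bound at
`λ = γ₀`, and `1 + x ≤ eˣ`.
-/

noncomputable section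

open MeasureTheory ProbabilityTheory Filter Set Topology
open scoped ENNReal BigOperators InnerProductSpace

namespace Summit.AtomisticToContinuum.HydrodynamicLimit.Theorems.NearConstantShortTimeHL

open Literature.MathematicalPhysics.KineticTheory Literature.Analysis.FluidPDE

/-! ## §1 Geometric tails of the three capped variables (abstract Chernoff input) -/

/-- **Tail of the capped square `min(ν, T²/ν)`** from two-sided Chernoff bounds
`P(x ≤ ±T) ≤ exp(−tx + Kνt²)` (`0 ≤ t ≤ t₀`): for `a ≤ t₀`, `Ka ≤ 1/2` and integers `j ≥ 1`,
`P(j ≤ min(ν, T²/ν)) ≤ 2 e^{−aj/2}` (the cap forces `j ≤ ν`, so `t = a√(j/ν) ≤ t₀` is admissible at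
the threshold `x = √(jν)`). [folklore] -/
theorem measure_le_cappedSq_le {α : Type*} [MeasurableSpace α] (P : Measure α) (T : α → ℝ)
    {ν t₀ K a : ℝ} (hν : 0 < ν) (ha0 : 0 ≤ a) (hat : a ≤ t₀) (haK : K * a ≤ 1 / 2)
    (hch : ∀ t, 0 ≤ t → t ≤ t₀ → ∀ x,
      P {ω | x ≤ T ω} ≤ ENNReal.ofReal (Real.exp (-(t * x) + K * ν * t ^ 2)) ∧
      P {ω | x ≤ -T ω} ≤ ENNReal.ofReal (Real.exp (-(t * x) + K * ν * t ^ 2)))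
    {j : ℕ} (hj : 1 ≤ j) :
    P {ω | (j : ℝ) ≤ min ν (T ω ^ 2 / ν)} ≤ ENNReal.ofReal (2 * Real.exp (-(a / 2 * j))) := by
  have hj0 : (0 : ℝ) ≤ j := Nat.cast_nonneg j
  rcases lt_or_ge ν j with hνj | hjν
  · have hempty : {ω | (j : ℝ) ≤ min ν (T ω ^ 2 / ν)} = ∅ :=
      Set.eq_empty_of_forall_notMem fun ω hω =>
        absurd ((le_min_iff.1 hω).1.trans_lt hνj) (lt_irrefl _)
    rw [hempty, measure_empty]
    exact bot_le
  · set x := Real.sqrt (j * ν) with hx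
    set t := a * Real.sqrt (j / ν) with ht
    have hs0 : 0 ≤ Real.sqrt (j / ν) := Real.sqrt_nonneg _
    have hs1 : Real.sqrt (j / ν) ≤ 1 := Real.sqrt_le_one.2 ((div_le_one hν).2 hjν)
    have ht0 : 0 ≤ t := mul_nonneg ha0 hs0
    have htt : t ≤ t₀ := (mul_le_of_le_one_right ha0 hs1).trans hat
    have htx : t * x = a * j := by
      rw [ht, hx, mul_assoc, ← Real.sqrt_mul (div_nonneg hj0 hν.le),
        show (j : ℝ) / ν * (j * ν) = j * j by field_simp, Real.sqrt_mul_self hj0]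
    have ht2 : K * ν * t ^ 2 = K * a * (a * j) := by
      rw [ht, mul_pow, Real.sq_sqrt (div_nonneg hj0 hν.le)]
      field_simp
    have hexp : -(t * x) + K * ν * t ^ 2 ≤ -(a / 2 * j) := by
      rw [htx, ht2]
      nlinarith [mul_le_mul_of_nonneg_right haK (mul_nonneg ha0 hj0)]
    obtain ⟨h1, h2⟩ := hch t ht0 htt x
    have hsub : {ω | (j : ℝ) ≤ min ν (T ω ^ 2 / ν)} ⊆ {ω | x ≤ T ω} ∪ {ω | x ≤ -T ω} := by
      intro ω hω
      have h2' : (j : ℝ) * ν ≤ T ω ^ 2 := (le_div_iff₀ hν).1 (le_min_iff.1 hω).2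
      have h3 : x ≤ |T ω| := by
        rw [hx, ← Real.sqrt_sq_eq_abs]
        exact Real.sqrt_le_sqrt h2'
      exact le_abs.1 h3
    calc P {ω | (j : ℝ) ≤ min ν (T ω ^ 2 / ν)} ≤ P ({ω | x ≤ T ω} ∪ {ω | x ≤ -T ω}) :=
          measure_mono hsub
      _ ≤ P {ω | x ≤ T ω} + P {ω | x ≤ -T ω} := measure_union_le _ _
      _ ≤ ENNReal.ofReal (Real.exp (-(a / 2 * j))) + ENNReal.ofReal (Real.exp (-(a / 2 * j))) :=
          add_le_add (h1.trans (ENNReal.ofReal_le_ofReal (Real.exp_le_exp.2 hexp)))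
            (h2.trans (ENNReal.ofReal_le_ofReal (Real.exp_le_exp.2 hexp)))
      _ = ENNReal.ofReal (2 * Real.exp (-(a / 2 * j))) := by
          rw [two_mul, ENNReal.ofReal_add (Real.exp_pos _).le (Real.exp_pos _).le]

/-- **Tail of the linear tail `T 𝟙{T > ν}`** from the one-sided Chernoff bound
`P(x ≤ T) ≤ exp(−tx + Kνt²)` (`0 ≤ t ≤ t₀`, `K ≥ 0`): for `a ≤ t₀`, `Ka ≤ 1/2` and `j ≥ 1`,
`P(j ≤ T 𝟙{T > ν}) ≤ 2 e^{−aj/2}` (Chernoff at `t = a` and the threshold `max(j, ν)`). [folklore] -/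
theorem measure_le_linearTail_le {α : Type*} [MeasurableSpace α] (P : Measure α) (T : α → ℝ)
    {ν t₀ K a : ℝ} (hK : 0 ≤ K) (ha0 : 0 ≤ a) (hat : a ≤ t₀) (haK : K * a ≤ 1 / 2)
    (hch : ∀ t, 0 ≤ t → t ≤ t₀ → ∀ x,
      P {ω | x ≤ T ω} ≤ ENNReal.ofReal (Real.exp (-(t * x) + K * ν * t ^ 2)))
    {j : ℕ} (hj : 1 ≤ j) :
    P {ω | (j : ℝ) ≤ if ν < T ω then T ω else 0} ≤ ENNReal.ofReal (2 * Real.exp (-(a / 2 * j))) := by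
  have hj1 : (1 : ℝ) ≤ j := Nat.one_le_cast.2 hj
  set m := max (j : ℝ) ν with hm
  have hνm : ν ≤ m := le_max_right _ _
  have hjm : (j : ℝ) ≤ m := le_max_left _ _
  have hm0 : 0 ≤ m := by linarith
  have hsub : {ω | (j : ℝ) ≤ if ν < T ω then T ω else 0} ⊆ {ω | m ≤ T ω} := by
    intro ω hω
    simp only [Set.mem_setOf_eq] at hω ⊢
    split_ifs at hω with h
    · exact max_le hω h.le
    · linarith
  have hexp : -(a * m) + K * ν * a ^ 2 ≤ -(a / 2 * j) := by
    have h1 : K * ν * a ^ 2 ≤ K * m * a ^ 2 :=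
      mul_le_mul_of_nonneg_right (mul_le_mul_of_nonneg_left hνm hK) (sq_nonneg a)
    nlinarith [mul_le_mul_of_nonneg_right haK (mul_nonneg ha0 hm0),
      mul_le_mul_of_nonneg_left hjm ha0]
  calc P {ω | (j : ℝ) ≤ if ν < T ω then T ω else 0} ≤ P {ω | m ≤ T ω} := measure_mono hsub
    _ ≤ ENNReal.ofReal (Real.exp (-(a * m) + K * ν * a ^ 2)) := hch a ha0 hat m
    _ ≤ ENNReal.ofReal (2 * Real.exp (-(a / 2 * j))) := by
        refine ENNReal.ofReal_le_ofReal ?_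
        have := Real.exp_le_exp.2 hexp
        linarith [Real.exp_pos (-(a / 2 * j))]

/-- **Tail of the capped squared norm `min(ν, ‖S‖²/ν)` of a vector sum** from the coordinate
Chernoff bounds `P(x ≤ ±S_l) ≤ exp(−tx + Kνt²/2)` (`t ≥ 0`, `K > 0`): for `j ≥ 1`,
`P(j ≤ min(ν, ‖S‖²/ν)) ≤ 6 e^{−j/(8K)}` (`‖S‖² ≥ jν` forces `|S_l| ≥ √(jν)/2` for some coordinate;
`t = √(j/ν)/(2K)`). [folklore] -/
theorem measure_le_cappedNormSq_le {α : Type*} [MeasurableSpace α] (P : Measure α) (S : α → V3)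
    {ν K : ℝ} (hν : 0 < ν) (hK : 0 < K)
    (hch : ∀ t, 0 ≤ t → ∀ x (l : Fin 3),
      P {ω | x ≤ S ω l} ≤ ENNReal.ofReal (Real.exp (-(t * x) + K * ν * t ^ 2 / 2)) ∧
      P {ω | x ≤ -S ω l} ≤ ENNReal.ofReal (Real.exp (-(t * x) + K * ν * t ^ 2 / 2)))
    {j : ℕ} (hj : 1 ≤ j) :
    P {ω | (j : ℝ) ≤ min ν (‖S ω‖ ^ 2 / ν)} ≤
      ENNReal.ofReal (6 * Real.exp (-(1 / (8 * K) * j))) := by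
  have hj0 : (0 : ℝ) ≤ j := Nat.cast_nonneg j
  rcases lt_or_ge ν j with hνj | hjν
  · have hempty : {ω | (j : ℝ) ≤ min ν (‖S ω‖ ^ 2 / ν)} = ∅ :=
      Set.eq_empty_of_forall_notMem fun ω hω =>
        absurd ((le_min_iff.1 hω).1.trans_lt hνj) (lt_irrefl _)
    rw [hempty, measure_empty]
    exact bot_le
  · set x := Real.sqrt (j * ν) / 2 with hx
    set t := Real.sqrt (j / ν) / (2 * K) with ht
    have ht0 : 0 ≤ t := by positivity
    have hx0 : 0 ≤ x := by positivity
    have hkey : Real.sqrt (j / ν) * Real.sqrt (j * ν) = j := by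
      rw [← Real.sqrt_mul (div_nonneg hj0 hν.le),
        show (j : ℝ) / ν * (j * ν) = j * j by field_simp, Real.sqrt_mul_self hj0]
    have h1 : t * x = j / (4 * K) := by
      rw [ht, hx, div_mul_div_comm, hkey]
      ring
    have h2 : K * ν * t ^ 2 / 2 = j / (8 * K) := by
      rw [ht, div_pow, Real.sq_sqrt (div_nonneg hj0 hν.le)]
      field_simp
      ring
    have hexp : -(t * x) + K * ν * t ^ 2 / 2 = -(1 / (8 * K) * j) := by
      rw [h1, h2]
      field_simp
      ring
    have hx2 : x ^ 2 = j * ν / 4 := by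
      rw [hx, div_pow, Real.sq_sqrt (by positivity)]
      norm_num
    have hsub : {ω | (j : ℝ) ≤ min ν (‖S ω‖ ^ 2 / ν)} ⊆
        ⋃ l : Fin 3, ({ω | x ≤ S ω l} ∪ {ω | x ≤ -S ω l}) := by
      intro ω hω
      have h2' : (j : ℝ) * ν ≤ ‖S ω‖ ^ 2 := (le_div_iff₀ hν).1 (le_min_iff.1 hω).2
      rw [EuclideanSpace.real_norm_sq_eq] at h2'
      obtain ⟨l, -, hl⟩ : ∃ l ∈ (Finset.univ : Finset (Fin 3)), (j : ℝ) * ν / 3 ≤ (S ω l) ^ 2 := by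
        refine Finset.exists_le_of_sum_le Finset.univ_nonempty ?_
        rw [Finset.sum_const, Finset.card_univ, Fintype.card_fin, nsmul_eq_mul]
        push_cast
        linarith
      have h3 : x ≤ |S ω l| := by
        have h4 := Real.sqrt_le_sqrt (show x ^ 2 ≤ (S ω l) ^ 2 by
          rw [hx2]; linarith [mul_nonneg hj0 hν.le])
        rwa [Real.sqrt_sq hx0, Real.sqrt_sq_eq_abs] at h4
      exact Set.mem_iUnion.2 ⟨l, le_abs.1 h3⟩
    calc P {ω | (j : ℝ) ≤ min ν (‖S ω‖ ^ 2 / ν)}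
        ≤ P (⋃ l : Fin 3, ({ω | x ≤ S ω l} ∪ {ω | x ≤ -S ω l})) := measure_mono hsub
      _ ≤ ∑ l : Fin 3, P ({ω | x ≤ S ω l} ∪ {ω | x ≤ -S ω l}) := measure_iUnion_fintype_le P _
      _ ≤ ∑ _l : Fin 3, (ENNReal.ofReal (Real.exp (-(1 / (8 * K) * j))) +
            ENNReal.ofReal (Real.exp (-(1 / (8 * K) * j)))) := by
          refine Finset.sum_le_sum fun l _ => (measure_union_le _ _).trans ?_
          obtain ⟨h5, h6⟩ := hch t ht0 x l
          rw [hexp] at h5 h6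
          exact add_le_add h5 h6
      _ = ENNReal.ofReal (6 * Real.exp (-(1 / (8 * K) * j))) := by
          rw [Finset.sum_const, Finset.card_univ, Fintype.card_fin, nsmul_eq_mul, Nat.cast_ofNat,
            ← ENNReal.ofReal_add (Real.exp_pos _).le (Real.exp_pos _).le, ← ENNReal.ofReal_ofNat 3,
            ← ENNReal.ofReal_mul (by norm_num)]
          congr 1
          ring

/-! ## §2 The three exponential moments, uniformly in `ν ≥ 1`; the linear bound -/

/-- **Exponential moment of the capped squared norm of the centred velocity sum**: for
`0 ≤ γ ≤ c_A/2`, `c_A = 1/(8RM)`, uniformly in `ν ≥ 1`, `k ≤ Rν` and the box,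
`E exp(γ min(ν, ‖Σᵢ(vᵢ − uᵢ)‖²/ν)) ≤ 6 e^{c_A/2} (1 + 2/c_A)`. [folklore] -/
theorem lintegral_exp_cappedNormSq_le {M R : ℝ} (hM : 1 ≤ M) (hR : 0 < R) {γ : ℝ} (hγ0 : 0 ≤ γ)
    (hγ : γ ≤ 1 / (8 * (R * M)) / 2) {ν : ℝ} (hν : 1 ≤ ν) {k : ℕ} (hk : (k : ℝ) ≤ R * ν)
    (u : Fin k → V3) (θ : Fin k → ℝ) (hbox : ∀ i, M⁻¹ ≤ θ i ∧ θ i ≤ M ∧ ‖u i‖ ≤ M) :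
    ∫⁻ v, ENNReal.ofReal (Real.exp (γ * min ν (‖∑ i, (v i - u i)‖ ^ 2 / ν)))
        ∂(Measure.pi fun i => gaussMeasure (u i) (θ i)) ≤
      ENNReal.ofReal (6 * Real.exp (1 / (8 * (R * M)) / 2) * (1 + 2 / (1 / (8 * (R * M))))) := by
  have hM0 : 0 < M := by linarith
  have hν0 : 0 < ν := by linarith
  have hK : 0 < R * M := by positivity
  refine lintegral_exp_mul_le_of_geometric_tail _
    (T := fun v : Fin k → V3 => min ν (‖∑ i, (v i - u i)‖ ^ 2 / ν)) ?_ ?_ (by positivity)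
    (by norm_num) ?_ hγ0 hγ
  · exact measurable_const.min (((measurable_velSum u).norm.pow_const 2).div_const ν)
  · exact fun v => le_min hν0.le (div_nonneg (sq_nonneg _) hν0.le)
  · intro j hj
    exact measure_le_cappedNormSq_le _ (fun v : Fin k → V3 => ∑ i, (v i - u i)) hν0 hK
      (fun t ht x l => chernoff_velCoord hM hk u θ hbox ht x l) hj

/-- **Exponential moment of the capped squared centred kinetic energy**: for `0 ≤ γ ≤ a/4`,
`a = min(1/(2M), 1/(8M³R))`, uniformly in `ν ≥ 1`, `k ≤ Rν` and the box,
`E exp(γ min(ν, (Σᵢ Yᵢ)²/ν)) ≤ 2 e^{a/4} (1 + 4/a)`. [folklore] -/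
theorem lintegral_exp_cappedEnergySq_le {M R : ℝ} (hM : 1 ≤ M) (hR : 0 < R) {γ : ℝ} (hγ0 : 0 ≤ γ)
    (hγ : γ ≤ min (1 / (2 * M)) (1 / (8 * M ^ 3 * R)) / 2 / 2) {ν : ℝ} (hν : 1 ≤ ν) {k : ℕ}
    (hk : (k : ℝ) ≤ R * ν) (u : Fin k → V3) (θ : Fin k → ℝ)
    (hbox : ∀ i, M⁻¹ ≤ θ i ∧ θ i ≤ M ∧ ‖u i‖ ≤ M) :
    ∫⁻ v, ENNReal.ofReal (Real.exp (γ *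
        min ν ((∑ i, (‖v i‖ ^ 2 / 2 - ‖u i‖ ^ 2 / 2 - 3 / 2 * θ i)) ^ 2 / ν)))
        ∂(Measure.pi fun i => gaussMeasure (u i) (θ i)) ≤
      ENNReal.ofReal (2 * Real.exp (min (1 / (2 * M)) (1 / (8 * M ^ 3 * R)) / 2 / 2) *
        (1 + 2 / (min (1 / (2 * M)) (1 / (8 * M ^ 3 * R)) / 2))) := by
  have hM0 : 0 < M := by linarith
  have hν0 : 0 < ν := by linarith
  obtain ⟨ha0, haK⟩ := min_rate_pos_and_le hM hR
  refine lintegral_exp_mul_le_of_geometric_tail _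
    (T := fun v : Fin k → V3 => min ν ((∑ i, (‖v i‖ ^ 2 / 2 - ‖u i‖ ^ 2 / 2 - 3 / 2 * θ i)) ^ 2 / ν))
    ?_ ?_ (by positivity) (by norm_num) ?_ hγ0 hγ
  · exact measurable_const.min (((measurable_energySum u θ).pow_const 2).div_const ν)
  · exact fun v => le_min hν0.le (div_nonneg (sq_nonneg _) hν0.le)
  · intro j hj
    exact measure_le_cappedSq_le _
      (fun v : Fin k → V3 => ∑ i, (‖v i‖ ^ 2 / 2 - ‖u i‖ ^ 2 / 2 - 3 / 2 * θ i)) hν0 ha0.le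
      (min_le_left _ _) haK (fun t ht0 ht x => chernoff_energySum hM hk u θ hbox ht0 ht x) hj

/-- **Exponential moment of the linear tail of the centred kinetic energy**: for `0 ≤ γ ≤ a/4`,
`a = min(1/(2M), 1/(8M³R))`, uniformly in `ν ≥ 1`, `k ≤ Rν` and the box,
`E exp(γ (Σᵢ Yᵢ) 𝟙{Σᵢ Yᵢ > ν}) ≤ 2 e^{a/4} (1 + 4/a)`. [folklore] -/
theorem lintegral_exp_linearTail_le {M R : ℝ} (hM : 1 ≤ M) (hR : 0 < R) {γ : ℝ} (hγ0 : 0 ≤ γ)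
    (hγ : γ ≤ min (1 / (2 * M)) (1 / (8 * M ^ 3 * R)) / 2 / 2) {ν : ℝ} (hν : 1 ≤ ν) {k : ℕ}
    (hk : (k : ℝ) ≤ R * ν) (u : Fin k → V3) (θ : Fin k → ℝ)
    (hbox : ∀ i, M⁻¹ ≤ θ i ∧ θ i ≤ M ∧ ‖u i‖ ≤ M) :
    ∫⁻ v, ENNReal.ofReal (Real.exp (γ *
        (if ν < ∑ i, (‖v i‖ ^ 2 / 2 - ‖u i‖ ^ 2 / 2 - 3 / 2 * θ i)
          then ∑ i, (‖v i‖ ^ 2 / 2 - ‖u i‖ ^ 2 / 2 - 3 / 2 * θ i) else 0)))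
        ∂(Measure.pi fun i => gaussMeasure (u i) (θ i)) ≤
      ENNReal.ofReal (2 * Real.exp (min (1 / (2 * M)) (1 / (8 * M ^ 3 * R)) / 2 / 2) *
        (1 + 2 / (min (1 / (2 * M)) (1 / (8 * M ^ 3 * R)) / 2))) := by
  have hM0 : 0 < M := by linarith
  have hν0 : 0 < ν := by linarith
  obtain ⟨ha0, haK⟩ := min_rate_pos_and_le hM hR
  have hTm := measurable_energySum u θ
  refine lintegral_exp_mul_le_of_geometric_tail _
    (T := fun v : Fin k → V3 => if ν < ∑ i, (‖v i‖ ^ 2 / 2 - ‖u i‖ ^ 2 / 2 - 3 / 2 * θ i)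
      then ∑ i, (‖v i‖ ^ 2 / 2 - ‖u i‖ ^ 2 / 2 - 3 / 2 * θ i) else 0)
    ?_ ?_ (by positivity) (by norm_num) ?_ hγ0 hγ
  · exact Measurable.ite (measurableSet_lt measurable_const hTm) hTm measurable_const
  · intro v
    show 0 ≤ (if ν < ∑ i, (‖v i‖ ^ 2 / 2 - ‖u i‖ ^ 2 / 2 - 3 / 2 * θ i)
      then ∑ i, (‖v i‖ ^ 2 / 2 - ‖u i‖ ^ 2 / 2 - 3 / 2 * θ i) else 0)
    split_ifs with h
    · linarith
    · exact le_rfl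
  · intro j hj
    exact measure_le_linearTail_le _
      (fun v : Fin k → V3 => ∑ i, (‖v i‖ ^ 2 / 2 - ‖u i‖ ^ 2 / 2 - 3 / 2 * θ i)) (by positivity)
      ha0.le (min_le_left _ _) haK (fun t ht0 ht x => (chernoff_energySum hM hk u θ hbox ht0 ht x).1)
      hj

/-- **One-particle linear bound**: for `M ≥ 1`, `0 < γ₀ ≤ 1/(2M)`, `0 ≤ s ≤ γ₀` and the box,
`E exp(s Y₊) ≤ exp((exp(4M³γ₀²)/γ₀) s)` (convexity of `exp` in the exponent,
`e^{γ₀Y₊} ≤ 1 + e^{γ₀Y}`, the sub-Gaussian bound at `λ = γ₀`, `1 + x ≤ eˣ`). [folklore] -/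
theorem lintegral_exp_mul_posPart_energy_le {M : ℝ} (hM : 1 ≤ M) {γ₀ : ℝ} (hγ₀ : 0 < γ₀)
    (hγM : γ₀ ≤ 1 / (2 * M)) {s : ℝ} (hs0 : 0 ≤ s) (hsγ : s ≤ γ₀) (u : V3) {θ : ℝ}
    (hθ1 : M⁻¹ ≤ θ) (hθ2 : θ ≤ M) (hu : ‖u‖ ≤ M) :
    ∫⁻ v, ENNReal.ofReal (Real.exp (s * max 0 (‖v‖ ^ 2 / 2 - ‖u‖ ^ 2 / 2 - 3 / 2 * θ)))
        ∂(gaussMeasure u θ) ≤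
      ENNReal.ofReal (Real.exp (Real.exp (4 * M ^ 3 * γ₀ ^ 2) / γ₀ * s)) := by
  have hmgf := lintegral_exp_mul_energy_gaussMeasure_le hM u hθ1 hθ2 hu (lam := γ₀)
    (by rwa [abs_of_pos hγ₀])
  have hsg : 0 ≤ s / γ₀ := div_nonneg hs0 hγ₀.le
  have hsg1 : s / γ₀ ≤ 1 := (div_le_one hγ₀).2 hsγ
  have hpt : ∀ v : V3,
      ENNReal.ofReal (Real.exp (s * max 0 (‖v‖ ^ 2 / 2 - ‖u‖ ^ 2 / 2 - 3 / 2 * θ))) ≤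
        1 + ENNReal.ofReal (s / γ₀) *
          ENNReal.ofReal (Real.exp (γ₀ * (‖v‖ ^ 2 / 2 - ‖u‖ ^ 2 / 2 - 3 / 2 * θ))) := by
    intro v
    set Y := ‖v‖ ^ 2 / 2 - ‖u‖ ^ 2 / 2 - 3 / 2 * θ with hY
    have hconv : Real.exp (s * max 0 Y) ≤ (1 - s / γ₀) + s / γ₀ * Real.exp (γ₀ * max 0 Y) := by
      have h := convexOn_exp.2 (Set.mem_univ 0) (Set.mem_univ (γ₀ * max 0 Y))
        (show 0 ≤ 1 - s / γ₀ by linarith) hsg (by ring)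
      simp only [smul_eq_mul, mul_zero, zero_add, Real.exp_zero, mul_one] at h
      have e : s / γ₀ * (γ₀ * max 0 Y) = s * max 0 Y := by
        field_simp
      rwa [e] at h
    have hmax : Real.exp (γ₀ * max 0 Y) ≤ 1 + Real.exp (γ₀ * Y) := by
      rcases le_total 0 Y with h | h
      · rw [max_eq_right h]
        linarith [Real.exp_pos (γ₀ * Y)]
      · rw [max_eq_left h, mul_zero, Real.exp_zero]
        linarith [Real.exp_pos (γ₀ * Y)]
    have hfin : Real.exp (s * max 0 Y) ≤ 1 + s / γ₀ * Real.exp (γ₀ * Y) := by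
      nlinarith [mul_le_mul_of_nonneg_left hmax hsg]
    calc ENNReal.ofReal (Real.exp (s * max 0 Y))
        ≤ ENNReal.ofReal (1 + s / γ₀ * Real.exp (γ₀ * Y)) := ENNReal.ofReal_le_ofReal hfin
      _ = 1 + ENNReal.ofReal (s / γ₀) * ENNReal.ofReal (Real.exp (γ₀ * Y)) := by
          rw [ENNReal.ofReal_add zero_le_one (by positivity), ENNReal.ofReal_one,
            ENNReal.ofReal_mul hsg]
  calc ∫⁻ v, ENNReal.ofReal (Real.exp (s * max 0 (‖v‖ ^ 2 / 2 - ‖u‖ ^ 2 / 2 - 3 / 2 * θ)))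
        ∂(gaussMeasure u θ)
      ≤ ∫⁻ v, (1 + ENNReal.ofReal (s / γ₀) *
          ENNReal.ofReal (Real.exp (γ₀ * (‖v‖ ^ 2 / 2 - ‖u‖ ^ 2 / 2 - 3 / 2 * θ))))
          ∂(gaussMeasure u θ) := lintegral_mono hpt
    _ = 1 + ENNReal.ofReal (s / γ₀) *
          ∫⁻ v, ENNReal.ofReal (Real.exp (γ₀ * (‖v‖ ^ 2 / 2 - ‖u‖ ^ 2 / 2 - 3 / 2 * θ)))
            ∂(gaussMeasure u θ) := by
        rw [lintegral_add_left measurable_const, lintegral_const, measure_univ, mul_one,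
          lintegral_const_mul' _ _ ENNReal.ofReal_ne_top]
    _ ≤ 1 + ENNReal.ofReal (s / γ₀) * ENNReal.ofReal (Real.exp (4 * M ^ 3 * γ₀ ^ 2)) := by
        gcongr
    _ = ENNReal.ofReal (1 + s / γ₀ * Real.exp (4 * M ^ 3 * γ₀ ^ 2)) := by
        rw [ENNReal.ofReal_add zero_le_one (by positivity), ENNReal.ofReal_one,
          ENNReal.ofReal_mul hsg]
    _ ≤ ENNReal.ofReal (Real.exp (Real.exp (4 * M ^ 3 * γ₀ ^ 2) / γ₀ * s)) := by
        refine ENNReal.ofReal_le_ofReal ?_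
        have h1 := Real.add_one_le_exp (s / γ₀ * Real.exp (4 * M ^ 3 * γ₀ ^ 2))
        have e : s / γ₀ * Real.exp (4 * M ^ 3 * γ₀ ^ 2) = Real.exp (4 * M ^ 3 * γ₀ ^ 2) / γ₀ * s := by
          ring
        rw [← e]
        linarith

/-! ## §3 The registered stub -/

/-- **BALL GAUSSIAN ESTIMATE** (registered stub `ball_gaussian_estimate`, the unfolded form of
`stub_ballGaussianEstimate : BallGaussianEstimate` of the line `small-tilt-domination`). For every
box size `M ≥ 1` and ball-content ratio `R > 0` there are `γ₀ > 0` and `B` such that: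
(i) for every `ν ≥ 1`, every `k ≤ Rν` and all means / temperatures in the box, under
`⊗ᵢ N(uᵢ, θᵢ I₃)` the capped quadratic forms of `S = Σᵢ (vᵢ − uᵢ)` and `T = Σᵢ Yᵢ`
(`Yᵢ = ‖vᵢ‖²/2 − ‖uᵢ‖²/2 − 3θᵢ/2`) together with the linear tail of `T` beyond `ν` satisfy
`E exp(γ₀ [min(ν, ‖S‖²/ν) + min(ν, T²/ν) + T 𝟙{T > ν}]) ≤ B`, uniformly in `ν`;
(ii) `E exp(s Y₊) ≤ exp(B s)` for `0 ≤ s ≤ γ₀`.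
Constants: `a = min(1/(2M), 1/(8M³R))`, `c_A = 1/(8RM)`, `γ₀ = min(c_A/6, a/12)`,
`B = 6e^{c_A/2}(1 + 2/c_A) + 2·2e^{a/4}(1 + 4/a) + e^{4M³γ₀²}/γ₀`. [folklore] -/
theorem ball_gaussian_estimate : ∀ M : ℝ, 1 ≤ M → ∀ R : ℝ, 0 < R → ∃ γ₀ : ℝ, 0 < γ₀ ∧ ∃ B : ℝ, (∀ ν : ℝ, 1 ≤ ν → ∀ k : ℕ, (k : ℝ) ≤ R * ν → ∀ (u : Fin k → V3) (θ : Fin k → ℝ), (∀ i, M⁻¹ ≤ θ i ∧ θ i ≤ M ∧ ‖u i‖ ≤ M) → ∫⁻ v, ENNReal.ofReal (Real.exp (γ₀ * (min ν (‖∑ i, (v i - u i)‖ ^ 2 / ν) + min ν ((∑ i, (‖v i‖ ^ 2 / 2 - ‖u i‖ ^ 2 / 2 - 3 / 2 * θ i)) ^ 2 / ν) + (if ν < ∑ i, (‖v i‖ ^ 2 / 2 - ‖u i‖ ^ 2 / 2 - 3 / 2 * θ i) then ∑ i, (‖v i‖ ^ 2 / 2 - ‖u i‖ ^ 2 / 2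 - 3 / 2 * θ i) else 0)))) ∂(Measure.pi fun i => gaussMeasure (u i) (θ i)) ≤ ENNReal.ofReal B) ∧ (∀ s : ℝ, 0 ≤ s → s ≤ γ₀ → ∀ (u : V3) (θ : ℝ), M⁻¹ ≤ θ → θ ≤ M → ‖u‖ ≤ M → ∫⁻ v, ENNReal.ofReal (Real.exp (s * max 0 (‖v‖ ^ 2 / 2 - ‖u‖ ^ 2 / 2 - 3 / 2 * θ))) ∂(gaussMeasure u θ) ≤ ENNReal.ofReal (Real.exp (B * s))) := by
  intro M hM R hR
  have hM0 : 0 < M := by linarith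
  set a : ℝ := min (1 / (2 * M)) (1 / (8 * M ^ 3 * R)) with ha
  set cA : ℝ := 1 / (8 * (R * M)) with hcA
  have ha0 : 0 < a := lt_min (by positivity) (by positivity)
  have hcA0 : 0 < cA := by positivity
  set γ₀ : ℝ := min (cA / 6) (a / 12) with hγ₀
  have hγ₀0 : 0 < γ₀ := lt_min (by positivity) (by positivity)
  have hγA : 3 * γ₀ ≤ cA / 2 := by
    have := min_le_left (cA / 6) (a / 12)
    linarith
  have hγT : 3 * γ₀ ≤ a / 2 / 2 := by
    have := min_le_right (cA / 6) (a / 12)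
    linarith
  have hγM : γ₀ ≤ 1 / (2 * M) := by
    have h1 := min_le_right (cA / 6) (a / 12)
    have h2 : a ≤ 1 / (2 * M) := min_le_left _ _
    linarith
  set BA : ℝ := 6 * Real.exp (cA / 2) * (1 + 2 / cA) with hBA
  set BT : ℝ := 2 * Real.exp (a / 2 / 2) * (1 + 2 / (a / 2)) with hBT
  set B₂ : ℝ := Real.exp (4 * M ^ 3 * γ₀ ^ 2) / γ₀ with hB₂
  have hBA0 : 0 ≤ BA := by positivity
  have hBT0 : 0 ≤ BT := by positivity
  have hB₂0 : 0 ≤ B₂ := by positivity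
  refine ⟨γ₀, hγ₀0, BA + BT + BT + B₂, ?_, ?_⟩
  · intro ν hν k hk u θ hbox
    have h3γ : 0 ≤ 3 * γ₀ := by positivity
    have hIA := lintegral_exp_cappedNormSq_le hM hR h3γ hγA hν hk u θ hbox
    have hIT1 := lintegral_exp_cappedEnergySq_le hM hR h3γ hγT hν hk u θ hbox
    have hIT2 := lintegral_exp_linearTail_le hM hR h3γ hγT hν hk u θ hbox
    refine (lintegral_exp_mul_add_three_le (Measure.pi fun i => gaussMeasure (u i) (θ i))
      (A := fun v : Fin k → V3 => min ν (‖∑ i, (v i - u i)‖ ^ 2 / ν))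
      (B := fun v : Fin k → V3 =>
        min ν ((∑ i, (‖v i‖ ^ 2 / 2 - ‖u i‖ ^ 2 / 2 - 3 / 2 * θ i)) ^ 2 / ν))
      (C := fun v : Fin k → V3 => if ν < ∑ i, (‖v i‖ ^ 2 / 2 - ‖u i‖ ^ 2 / 2 - 3 / 2 * θ i)
        then ∑ i, (‖v i‖ ^ 2 / 2 - ‖u i‖ ^ 2 / 2 - 3 / 2 * θ i) else 0)
      (measurable_const.min (((measurable_velSum u).norm.pow_const 2).div_const ν))
      (measurable_const.min (((measurable_energySum u θ).pow_const 2).div_const ν)) γ₀).trans ?_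
    refine (add_le_add (add_le_add hIA hIT1) hIT2).trans ?_
    rw [← ENNReal.ofReal_add hBA0 hBT0, ← ENNReal.ofReal_add (add_nonneg hBA0 hBT0) hBT0]
    exact ENNReal.ofReal_le_ofReal (by linarith)
  · intro s hs0 hsγ u θ hθ1 hθ2 hu
    refine (lintegral_exp_mul_posPart_energy_le hM hγ₀0 hγM hs0 hsγ u hθ1 hθ2 hu).trans ?_
    refine ENNReal.ofReal_le_ofReal (Real.exp_le_exp.2 ?_)
    exact mul_le_mul_of_nonneg_right (by linarith) hs0

end Summit.AtomisticToContinuum.HydrodynamicLimit.Theorems.NearConstantShortTimeHL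

end
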